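import Mathlib
import HarnessLib
import HarnessLib.Audit
import Summits.CriticalPhenomena.Statement
import HarnessLib.Audit.Status.Attr

/-!
Route: SAWCircleScreening

DORMANT since 2026-08-22T09:31:08Z (reconciler: no traction for 5.2 d (last activity item-evidence-added at 2026-08-17T03:07:15Z); parked, not closed — `ledger route dormant route-CriticalPhenomena-SAWCircleScreening --off` to reactivat) — unstaffed, not closed; items shared with open routes are served there. `ledger route dormant <id> --off` reactivates.

# Route SAWCircleScreening — one endpoint convention suffices — circle-bridge screens couple all
endpoint approximations of the critical SAW

X = (EC) ∧ (I₁) — "one endpoint convention suffices". (EC) EndpointCoupling: for every Dobrushin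
domain and ANY two endpoint
approximations (Literature.Probability.RandomPlanarGeometry.SAW.IsEndpointApprox) the critical SAW
laws pushed to CurveClass ℂ are
asymptotically equal in Lévy–Prokhorov distance (an explicit coupling: the curves differ only inside
vanishing balls around the marked
points); (I₁) SomeApproxLimit: for every Dobrushin domain SOME endpoint approximation converges to
chordal SLE_{8/3}. The route's own
mathematics is the lattice engine of card circle-bridge-screening behind (EC): a circle crossed
exactly once is an EXACT Markov screen
for the x_c^{|γ|}-weighted walk, and three uniform lattice inputs — S1 CircleBridgeAbundance (bridge
radii are abundant at every scale),
S2 ScreenOverlap (integrated Harnack: screen data for different near data overlap by a fixed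
fraction), S3 NoDeepReturn (no deep
return towards the start, a Kemppainen–Smirnov G3-type bound for concentric annuli) — drive a
total-variation contraction across scales
(support ScreeningRecursion ⇒ EndpointCouplingTame). (I₁) is the identification input, owned by the
identification routes; any ONE
convention (e.g. boundary vertices, where observables live) suffices.
Lean: `EndpointCoupling ∧ SomeApproxLimit` with EndpointCoupling := `∀ (D :
Literature.Probability.RandomPlanarGeometry.DobrushinDomain) (a b a' b' : ℝ →
Literature.Probability.LatticeModels.Site 2),
Literature.Probability.RandomPlanarGeometry.SAW.IsEndpointApprox D a b →
Literature.Probability.RandomPlanarGeometry.SAW.IsEndpointApprox D a' b' → Filter.Tendsto (fun δ =>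
MeasureTheory.levyProkhorovDist ((Literature.Probability.RandomPlanarGeometry.SAW.law D.carrier δ (a
δ) (b δ)).map (fun γ => γ.curve)) ((Literature.Probability.RandomPlanarGeometry.SAW.law D.carrier δ
(a' δ) (b' δ)).map (fun γ => γ.curve))) (nhdsWithin 0 (Set.Ioi 0)) (nhds 0)` and SomeApproxLimit :=
`∀ D : Literature.Probability.RandomPlanarGeometry.DobrushinDomain, ∃ a b : ℝ →
Literature.Probability.LatticeModels.Site 2,
Literature.Probability.RandomPlanarGeometry.SAW.IsEndpointApprox D a b ∧
Literature.Probability.RandomPlanarGeometry.ConvergesInLawToSLE ((8 : NNReal) / 3) D (fun δ (γ :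
Literature.Probability.RandomPlanarGeometry.SAW.DomainSAW D.carrier δ (a δ) (b δ)) => γ.curve) (fun
δ => Literature.Probability.RandomPlanarGeometry.SAW.law D.carrier δ (a δ) (b δ))`

## Assembly
Fix D, a, b with IsEndpointApprox. SomeApproxLimit gives (a′,b′) and an SLE_{8/3} random curve Γ
with TendstoLaw along (a′,b′);
EndpointCoupling gives LP(law∘curve⁻¹ along (a,b), along (a′,b′)) → 0. On the separable metric space
CurveClass ℂ the Lévy–Prokhorov
metric metrises weak convergence of probability measures (Mathlib
MeasureTheory.LevyProkhorov.eq_convergenceInDistribution), both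
families are eventually probability laws (IsEndpointApprox.reachable; finiteness of DomainSAW for
bounded Ω, δ > 0), so the LP triangle
inequality transfers TendstoLaw to (a,b) with the same Γ; measurability is SAW.aemeasurable_curve.
Standard reductions only
(converging-together lemma, Billingsley1999 Thm 3.1); est. 150–300 lines.

Rationale: WHY THIS LINE. Every printed form of the conjecture uses ONE endpoint convention (nearest vertices:
LawlerSchrammWerner2004SAW §3.4.2, DuminilCopinSmirnov2012
Conj. 1, DuminilCopinKozmaYadin2014 §1), and every identification technology (parafermionic/harmonic
observables, Kennedy–Lawler boundary
densities KennedyLawler2013) needs the walk to START ON the discrete boundary, whereas the typed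
conjunct quantifies over ALL IsEndpointApprox
(mesoscopic interior starts included); the refutation guard stmt-CriticalPhenomena-0776 records this
gap and no route attacks it. The card's
mechanism closes it by a lattice argument that needs no limit, no observable and no exponent: the
single-crossing screen (exact
multiplicativity of x_c^{|γ|}, the radial cousin of Kesten's bridge lines, Kesten1963SAW /
MadrasSlade1993 §4.2) plus the
separation ⇒ coupling ⇒ memory-loss pipeline imported from planar LERW and percolation (Masson2009
Prop. 'indep' and Thm 4.7;
GarbanPeteSchramm2013Pivotal §3 Prop. 11 with Lemma 13; KemppainenSmirnov2017 §2.1.3 Conditions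
G2/G3). Continuum sanity: for the
restriction measure of exponent 5/8 (= SLE_{8/3}) bridge points EXIST, form a scale-invariant
perfect set of Hausdorff dimension 3/4 whose
heights are the range of a stable subordinator (AlbertsDuminilCopin2010 Thm 1.2–1.3) — exactly the
continuum shadow of S1 iterated over
octaves — while they are empty for exponent ≥ 1 (Brownian excursion; no points of increase),
matching the card's caution that S1 encodes
diluteness. Imported areas: coupling/renewal theory (maximal coupling, regenerative sets), planar
separation lemmas; no conformal input.

RANKED CRUXES. #0 Target (target) — X = EndpointCoupling ∧ SomeApproxLimit (§ Thesis). (why it might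
fail: EC for ROUGH marked prime ends is reached by no Euclidean screen (needs conformal screens à la
KS C2/C3); I₁ is the SAW conjecture for one convention — open since 2004.)
[LawlerSchrammWerner2004SAW, DuminilCopinSmirnov2012, KemppainenSmirnov2017]
#2 CircleBridgeAbundance (crux) — S1 of the card, made precise. Universal c₀ > 0: for every Jordan
domain D, centre c, scale ρ ≥ 2δ, with D ∩ B(c,4ρ) EXACTLY a half-disc through c (u ≠ 0) or the full
disc (u = 0), arbitrary near data K ⊆ B̄(c,ρ) removed, start a with |δa − c| ≤ ρ, target b beyond
4ρ, a, b joined in (D∖K)_δ: with law-probability ≥ c₀ some grid circle C(c, 2ρ + jδ) ⊂ [2ρ,3ρ] is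
crossed exactly once (prefix inside the open ball, suffix outside). Most informative item: it
decides whether the exact screen is available at every scale; implied by ScreenOverlap (diagonal
case K = K′). [difficulty: L] (why it might fail: RSW-strength one-curve bound, open on ℤ² at x_c;
fails for κ>4 analogues (SLE₆ explorer) and at x>x_c (DCKY space filling), so it encodes diluteness;
uniformity down to ρ=2δ and over adversarial near data K is untested.) [AlbertsDuminilCopin2010 (Thm
1.2: bridge points of restriction hulls / dim 2−2α = 3/4 at α = 5/8 / empty iff α ≥ 1),
Kesten1963SAW, MadrasSlade1993 (§4.2 bridges/renewal), DuminilCopinKozmaYadin2014 (Thm 1),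
KemppainenSmirnov2017 (§2.1.3 Condition G2),
Summits/CriticalPhenomena/SAWScalingLimit/Ideas/circle-bridge-screening.md (S1)]
#3 ScreenOverlap (crux) — S2 of the card (CrossingHarnack) in the integrated form the coupling
consumes. Universal c₁ > 0: same far geometry as S1 (flat in B(c,4ρ)), two near data (K, a), (K′,
a′) inside B̄(c,ρ), same target b: the laws of the CANONICAL SCREEN DATA (smallest grid radius r_j ∈
[2ρ,3ρ] crossed exactly once, and its exit edge (x,y)) under the two laws overlap: Σ_{(j,x,y)}
min(P_{K,a}, P_{K′,a′}) ≥ c₁ — maximal coupling of the screen succeeds with probability ≥ c₁, after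
which the suffix laws (x_c-SAW from y to b outside the ball) coincide exactly. [deps:
CircleBridgeAbundance] [difficulty: XL] (why it might fail: An
elliptic-Harnack/quasi-multiplicativity statement for critical SAW exit densities across an annulus:
in print only Hammersley–Welsh unfolding (loss e^{C√n}) and DC–Hammond/DGHM surgery; near data
hugging the flat boundary may skew exit-edge laws beyond a universal c₁.) [Masson2009 (Prop. 'indep'
p.4: independence up to constants across scales for LERW / Thm 4.7 separation lemma),
GarbanPeteSchramm2013Pivotal (§3 Prop. 11 / Lemma 13), DuminilCopinHammond2013,
LawlerSchrammWerner2004SAW (half-plane kernel by Madras–Slade monotonicity),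
Summits/CriticalPhenomena/SAWScalingLimit/Ideas/circle-bridge-screening.md (S2),
Summits/CriticalPhenomena/SAWScalingLimit/Ideas/constant-loss-saw-comparison.md]
#4 NoDeepReturn (crux) — S3 (the input the card's recursion silently needs: single crossing is
decided only at the end of the walk, so the scale iteration is made adapted by proxy screens at the
exit time of B(c,Mρ) plus control of DEEP RETURNS). For every ε > 0 there is M ≥ 4 such that,
uniformly over Jordan far geometry flat in B(c,Mρ), near data K ⊆ B̄(c,ρ), start within ρ, target
beyond Mρ: law-probability(after first reaching distance ≥ Mρ from c the walk comes back within 3ρ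
of c) ≤ ε. A Kemppainen–Smirnov G3-type power bound restricted to annuli concentric at the start.
[difficulty: L] (why it might fail: A G3/C3-type unforced-crossing bound for critical SAW, the same
kind of input tightness routes lack (no RSW/FKG for SAW; KS §4 verifies G2 only via FKG); uniformity
over near data K and down to ρ=2δ (return adjacent to the start) is untested.)
[KemppainenSmirnov2017 (§2.1.3 Conditions G2/G3 / §2.2 equivalence with C2/C3),
AizenmanBurchardDuke1999, DuminilCopinHammond2013,
Summits/CriticalPhenomena/SAWScalingLimit/Ideas/saw-rsw-from-kesten-renewal-tightness.md]
#5 EndpointCoupling (crux) — (EC), the conjunct-facing deliverable (card J3, coupling form of the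
guard stmt-CriticalPhenomena-0776): for every Dobrushin domain D and endpoint approximations (a,b),
(a′,b′), the Lévy–Prokhorov distance between the pushed-forward laws law_δ(a_δ,b_δ)∘curve⁻¹ and
law_δ(a′_δ,b′_δ)∘curve⁻¹ on CurveClass ℂ tends to 0 as δ → 0+. For domains flat near both marked
points it follows from S2 ∧ S3 (support ScreeningRecursion); general Jordan domains are NOT
decomposed yet. [deps: ScreenOverlap, NoDeepReturn] [difficulty: XL] (why it might fail: Implied by
the conjunct (+IsSLECurve.map_eq) but open; at ROUGH prime ends (boundary oscillating at all scales)
Euclidean screens fail for every δ, so this route reaches it only for tame marked points;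
Kennedy–Lawler lattice effects must cancel in the normalised law.) [KennedyLawler2013 (p.11: lattice
effects persisting in boundary densities), LawlerSchrammWerner2004SAW (§3.4.2 nearest-point
convention), DuminilCopinSmirnov2012 (Conj. 1), Billingsley1999 (Thm 3.1 converging together),
stmt-CriticalPhenomena-0776]
#6 SomeApproxLimit (crux) — (I₁), the identification input, deliberately the WEAKEST form: for every
Dobrushin domain there EXIST endpoint approximations (a,b) with IsEndpointApprox along which the
critical SAW law converges to chordal SLE_{8/3} (ConvergesInLawToSLE 8/3). Any convention proved by
any identification route (parafermion, restriction rigidity, FKG+AB, …) discharges it; not this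
route's mechanism and not to be staffed through it. [difficulty: open-problem] (why it might fail:
It is the Lawler–Schramm–Werner conjecture for one convention per domain: existence and conformal
covariance of the limit are open on every lattice (LSW04 p.3); on ℤ² no discrete-holomorphic
observable is known.) [LawlerSchrammWerner2004SAW (§3.4.2 / Prediction 1), DuminilCopinSmirnov2012
(Conjecture 1), stmt-CriticalPhenomena-0783]
#9 EndpointCouplingTame (support) — (EC) restricted to Dobrushin domains that are EXACTLY flat (open
half-discs) in some ball around each marked point — the class where the lattice engine applies
verbatim at all small scales (rectangles and polygons with marked points on edges, half-discs, …).
Target of the glue ScreeningRecursion; also provable from EndpointCoupling in one line. [difficulty: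
L] [Summits/CriticalPhenomena/SAWScalingLimit/Ideas/circle-bridge-screening.md (J3),
KennedyLawler2013]
#9 ScreeningRecursion (support) — the card's mechanism as a theorem: ScreenOverlap → NoDeepReturn →
EndpointCouplingTame. Proof plan (planner notes): (i) EXACT SCREEN — on {canonical screen =
(r_j,(x,y))} the law factorises as (prefix law inside B(c,r_j)) ⊗ (x_c-SAW from y to b in (D∖K)_δ
outside the open ball), the second factor independent of the near data (realise it as SAW.law (D ∖
K″) with K″ = ball minus chord segments); (ii) scales ρ_i = M^i ρ_0 about c = D.pt 0: maximal
coupling of screen data succeeds w.p. ≥ c₁ (S2), mismatched/none branches are mixtures of class laws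
at scale ρ_{i+1} by domain Markov at the exit time of B(c,Mρ_i) (past vertices as near data), up to
the deep-return error η(M) (S3): d_i ≤ (1−c₁)d_{i+1} + Cη(M), so d_0 ≤ (1−c₁)^m + Cη(M)/c₁; choose M
then δ (m(δ) → ∞ since δ·a_δ, δ·a′_δ → pt 0); (iii) coupled walks agree after a single exit of B(pt
0, ρ_m) ⇒ curve distance ≤ 2ρ_m; same at pt 1 by exact reversal of SAW.law; Strassen-free LP bound
from the coupling; largest-component bookkeeping (small balls never carry the largest component).
[difficulty: L] [GarbanPeteSchramm2013Pivotal (§3 proof of Prop. 11: induction over scales r_i =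
8^{N−i}r), Masson2009 (Thm 4.7/4.10), AlbertsDuminilCopin2010 (§4: renewal at bridge lines /
non-adaptedness of bridge times handled by an enlarged filtration), Billingsley1999]

TWO-LAYER PLAN. EndpointCoupling ⇐ EndpointCouplingTame → TameToGeneral → EndpointCoupling, where
TameToGeneral needs S1–S3 in a wider uniformity class
(sector sandwich for conical/C¹ marked points; Kemppainen–Smirnov-style CONFORMAL screens —
avoidable cross-cuts of fixed modulus — for
rough prime ends). ScreenOverlap ⇐ ExitHarnack (pointwise comparability of exit-edge densities at
radius 2ρ–3ρ for starts inside ρ) →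
CanonicalScreenBookkeeping → ScreenOverlap. NoDeepReturn ⇐ OneAnnulusBound (fixed modulus, constant
< 1) → KS-type multiplicativity
over concentric annuli → NoDeepReturn. Nothing filed now.

KILL CRITERIA. ¬CircleBridgeAbundance in the flat class (single-exit frequency per octave → 0 as ρ/δ
→ ∞, or an adversarial near datum K killing it
uniformly) closes the route outright (close --reason refuted:CircleBridgeAbundance): without screens
there is no engine. ¬ScreenOverlap with
S1 true ⇒ pivot to ratio LIMITS along δ → 0 instead of uniform constants (Kesten-type ratio-limit
route) — a different thesis. ¬NoDeepReturn
would be major negative knowledge for every tightness route as well (a G3 failure at the start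
point); pivot impossible, close.
¬EndpointCoupling (an approximation-dependent limit) REFUTES THE CONJUNCT as typed (guard 0776
fires) — report, do not repair.
SAWScalingLimit proved for all approximations elsewhere moots the route; proved for one convention
elsewhere makes this route the closer.

NOT DECOMPOSED YET. The passage tame → general marked points (curved, conical, rough prime ends:
needs the sector-sandwich or conformal uniformity class for
S1–S3; deliberately not typed before S1 is tested in the flat class); pointwise exit-density Harnack
behind S2; the fixed-modulus
one-annulus bound behind S3; Kennedy–Lawler locality (card J2) and kernel factorisation (card J1,
wanted by laplacian-five-eighths-walk /
target-switching cards) — same engine, not conjunct-facing here, to be filed as support when those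
cards are routed; interior-centre
(u = 0) uses of S1–S3.

CHEAPEST FALSIFIER. Exact enumeration / transfer matrix of x_c-weighted walks in half-discs of
radius R = 8…40 lattice units crossing from a start within
R/4 to the arc at R (kit job; μ ∈ [2.6, 2.7] is in tree so x_c-inequalities are certified by
interval arithmetic): the frequency of
"some circle of radius in [R/2, 3R/4] crossed exactly once" must stay bounded below as R grows and
under adversarial slits K inside R/4;
a frequency decaying like a power of R kills S1 and the route. Not run here (hub is compute-free for
planners in this unit; recorded
for the refuter). Literature check already done: no SAW annulus quasi-multiplicativity or
bridge-radius bound in print (zbMATH/Crossref 0 hits).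

NUMBERS. Continuum bridge-point dimension for restriction exponent α: 2 − 2α
(AlbertsDuminilCopin2010 Thm 1.2); α = 5/8 ⇒ 3/4; bridge heights =
closure of the range of a stable subordinator of index 3/4 (Thm 1.3) ⇒ P(no bridge height in (h,
Mh)) ≍ M^{−3/4}. μ(ℤ²) ∈ [2.6, 2.7]
(LawlerSchrammWerner2004SAW_connectiveConstant_bounds, in tree). GPS coupling: scales r_i = 8^{N−i}
r, failure probability (r/R)^k.
Items at open: 9 (5 cruxes, 1 target, 1 assembly, 2 support).

DEFINITION REQUESTS. None needed to type the items (screens, grid radii and deep returns are inlined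
over SAW.DomainSAW.walk.getVert and
Literature.Probability.LatticeModels.meshPoint). Nice-to-have later: `SAW.DomainSAW.singleExitIndex`
(the inlined screen predicate) and a reversal lemma
`SAW.law Ω δ b a = (SAW.law Ω δ a b).map reverse` in Literature/Probability/RandomPlanarGeometry
(support of ScreeningRecursion).

Novelty: Searches (2026-08-15): `lit search --source zbmath "self-avoiding walk quasi-multiplicativity"` (0),
`… "self-avoiding walk separation lemma"` (0),
`… "critical self-avoiding walk coupling"` (10, all lace-expansion/RG, none planar-critical), `…
"self-avoiding walk mixing boundary"` (2, irrelevant),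
`… "self-avoiding walk bridge decomposition scaling limit"` (1: arXiv:0909.0203); `lit search
--source crossref "self-avoiding walk scaling limit
coupling total variation"` (10: KennedyLawler2013, LawlerSchrammWerner2004SAW, Slade 1989, …, none
on couplings of approximations); `lit vsearch`
(coupling of nearby-started SAWs / memory loss / annulus quasi-multiplicativity: Lawler2005 p.241
LERW, MadrasSlade1993 ch.7–9 only); `lit read` +
grep of arXiv:0909.0203, 1008.1378, 0806.0357, 1212.6215, 1109.3091 (theorem numbers above);
OpenAlex/arXiv/S2 HTTP 429 and `lit galaxy search
--star all` queue-saturated at filing (recorded in NOTES.md; the card's novelty audit of 2026-08-15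
ran zbMATH/Crossref/hybrid with the same outcome).
Nearest prior art found: AlbertsDuminilCopin2010 (continuum bridge LINES of restriction measures,
half-plane, no lattice uniformity, no coupling);
Masson2009 / GarbanPeteSchramm2013Pivotal §3 / Beneš–Lawler–Viklund arXiv:1402.7345 (separation ⇒
coupling ⇒ ratio limits for LERW and percolation,
not SAW); KennedyLawler2013 (the boundary lattice effect EC must absorb); LawlerSchrammWerner2004SAW
App. (half-plane SAW kernel by monotonicity).
Delta: isolates the exact  [refs: 0909.0203, 1402.7345, KennedyLawler2013, Lawler2005, MadrasSlade1993, AlbertsDuminilCopin2010, Masson2009]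

Barriers (technique_class: screening-coupling, ratio-limit, boundary-harnack-saw): - technique_class: screening-coupling, ratio-limit, boundary-harnack-saw
- Literature.Barriers.CriticalPhenomena.SAWNotKineticallyGrown: evaded — the screen uses only the
Gibbs/domain-Markov structure of the chordal MEASURE (conditional independence across a
single-crossing circle, exact multiplicativity of x_c^{|γ|}), never a growth rule; S1–S3 are
statements about the static law.
- Literature.Barriers.CriticalPhenomena.SupercriticalSAWSpaceFilling: respected — S1 is false for x
> x_c (DCKY space filling forces re-crossings) and every item is pinned to SAW.law at x_c = 1/μ;
nothing is claimed open in x. The kill criterion names this: S1 is a diluteness statement.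
- Literature.Barriers.CriticalPhenomena.NienhuisWeightsExcludeVertexSAW: not met — no loop/vertex
weights, no observable.
- Literature.Barriers.CriticalPhenomena.ParafermionicHalfCauchyRiemann: not met — no discrete
holomorphicity is used; the route is precisely what lets an observable-based ONE-convention
identification (boundary starts) reach the ∀-approximation conjunct.
- Literature.Barriers.CriticalPhenomena.GridSAWCountingSharpPComplete: irrelevant — only
ratios/overlaps of partition functions with universal constants, never exact counts.
- Literature.Barriers.CriticalPhenomena.SAWNoUnitaryCFT: not met — no CFT/unitarity input.
- Negatives index: the refuted all-δ Tight (stmt-CriticalPhenomena-0772: IsTightLaws over δ ∈ (0,1]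
vs eventual hypotheses) is steered around — every statement here is eventual (𝓝[>]0)

History (route lifecycle, newest last):
- 2026-08-15T11:49:25Z · rev 1: restated Target (stmt-CriticalPhenomena-5461) — inline Target: the rank-0 item is rendered before EndpointCoupling/SomeApproxLimit, so the by-name conjunction was blocked (forward reference); same statement, (planner-plancard-CriticalPhenomena-SAWScaling-f56983b5-0)
- 2026-08-16T03:59:44Z · AUTO-CRUX (backfill): Target — hypotheses of the deciding theorem that nothing in the route derives are cruxes (operator:999:1085951)
- 2026-08-22T09:31:08Z · DORMANT — reconciler: no traction for 5.2 d (last activity item-evidence-added at 2026-08-17T03:07:15Z); parked, not closed — `ledger route dormant route-CriticalPhenomen (operator:999:540563)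

sub-problem: SAWScalingLimit · status: dormant · opened planner-plancard-CriticalPhenomena-SAWScaling-f56983b5-0 2026-08-15T11:41:15Z · rev 4 · ledger route-CriticalPhenomena-SAWCircleScreening
GENERATED by the gate from the ledger (D-0016/17). Provers cite these decls: `theorem foo : Summit.CriticalPhenomena.SAWScalingLimit.Theses.SAWCircleScreening.<Decl> := …` in Summits/CriticalPhenomena/SAWScalingLimit/Theorems/<Name>.lean.
-/

namespace Summit.CriticalPhenomena.SAWScalingLimit.Theses.SAWCircleScreening

open scoped BigOperators Topology Manifold Classical MeasureTheory ProbabilityTheory Matrix InnerProductSpace ComplexConjugate ContinuousMap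
open Filter Set Function TopologicalSpace MeasureTheory

attribute [summit_statement] _root_.SAWScalingLimit

-- earlier Target (stmt-CriticalPhenomena-5461, replaced 2026-08-15T11:49:25Z -> stmt-CriticalPhenomena-6642): retired by None — EndpointCoupling ∧ SomeApproxLimit
/-- item stmt-CriticalPhenomena-6642 · crux (kind.auto-crux: conjecture-grade) · rank 0 · open · by planner
why it might fail: EC ∧ I₁ is as strong as the conjunct: I₁ is the LSW conjecture for one convention (open since 2004; no ℤ² observable), and EC at marked points that are rough prime ends is reached by no Euclidean screen at any δ — only the conjunct itself is known to imply it; S1–S3 cover tame marked points only.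
sources: LawlerSchrammWerner2004SAW, DuminilCopinSmirnov2012, KemppainenSmirnov2017, KennedyLawler2013, arXiv:1109.3091
[target] X = EndpointCoupling ∧ SomeApproxLimit (§ Thesis), conjuncts inlined because the target is
rendered before the crux decls in the route file. -/
@[route_item "route-CriticalPhenomena-SAWCircleScreening", crux]
def Target : Prop :=
  (∀ (D : Literature.Probability.RandomPlanarGeometry.DobrushinDomain) (a b a' b' : ℝ → Literature.Probability.LatticeModels.Site 2), Literature.Probability.RandomPlanarGeometry.SAW.IsEndpointApprox D a b → Literature.Probability.RandomPlanarGeometry.SAW.IsEndpointApprox D a' b' → Filter.Tendsto (fun δ => MeasureTheory.levyProkhorovDist ((Literature.Probability.RandomPlanarGeometry.SAW.law D.carrier δ (a δ) (b δ)).map (fun γ => γ.curve)) ((Literature.Probability.RandomPlanarGeometry.SAW.law D.carrier δ (a' δ) (b' δ)).map (fun γ => γ.curve))) (nhdsWithin 0 (Set.Ioi 0)) (nhds 0)) ∧ (∀ D : Literature.Probability.RandomPlanarGeometry.DobrushinDomain, ∃ a b : ℝ → Literature.Probability.LatticeModels.Site 2, Literature.Probability.RandomPlanarGeometry.SAW.IsEndpointApprox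 D a b ∧ Literature.Probability.RandomPlanarGeometry.ConvergesInLawToSLE ((8 : NNReal) / 3) D (fun δ (γ : Literature.Probability.RandomPlanarGeometry.SAW.DomainSAW D.carrier δ (a δ) (b δ)) => γ.curve) (fun δ => Literature.Probability.RandomPlanarGeometry.SAW.law D.carrier δ (a δ) (b δ)))

/-- item stmt-CriticalPhenomena-5462 · crux · rank 2 · open · by planner
why it might fail: δ-uniform one-curve RSW-type bound for x_c-SAW on ℤ², none in print (no RSW/FKG for SAW); needed down to ρ=2δ, over adversarial near data K and any far geometry (dead-end fjords off the flat ball cost only O(1) at x_c); continuum bridge radii have measure 0 (dim 3/4): rests on lattice crossings.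
sources: AlbertsDuminilCopin2010, arXiv:0909.0203, DuminilCopinKozmaYadin2014, DuminilCopinGangulyHammondManolescu2020, MadrasSlade1993, Kesten1963SAW
[crux] S1 of the card, made precise. Universal c₀ > 0: for every Jordan domain D, centre c, scale ρ
≥ 2δ, with D ∩ B(c,4ρ) EXACTLY a half-disc through c (u ≠ 0) or the full disc (u = 0), arbitrary
near data K ⊆ B̄(c,ρ) removed, start a with |δa − c| ≤ ρ, target b beyond 4ρ, a, b joined in
(D∖K)_δ: with law-probability ≥ c₀ some grid circle C(c, 2ρ + jδ) ⊂ [2ρ,3ρ] is crossed exactly once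
(prefix inside the open ball, suffix outside). Most informative item: it decides whether the exact
screen is available at every scale; implied by ScreenOverlap (diagonal case K = K′). [difficulty: L] -/
@[route_item "route-CriticalPhenomena-SAWCircleScreening", crux]
def CircleBridgeAbundance : Prop :=
  ∃ c₀ : ℝ, 0 < c₀ ∧ ∀ (D : Literature.Probability.RandomPlanarGeometry.JordanDomain) (K : Set ℂ) (c u : ℂ) (δ ρ : ℝ) (a b : Literature.Probability.LatticeModels.Site 2), 0 < δ → 2 * δ ≤ ρ → K ⊆ Metric.closedBall c ρ → D.carrier ∩ Metric.ball c (4 * ρ) = {z | u = 0 ∨ 0 < ((z - c) * u).im} ∩ Metric.ball c (4 * ρ) → dist (Literature.Probability.LatticeModels.meshPoint δ a) c ≤ ρ → 4 * ρ ≤ dist (Literature.Probability.LatticeModels.meshPoint δ b) c → (Literature.Probability.LatticeModels.discreteDomainGraph (D.carrier \ K) δ).Reachable a b → ENNReal.ofReal c₀ ≤ Literature.Probability.RandomPlanarGeometry.SAW.law (D.carrier \ K) δ a b {γ | ∃ j : ℕ, 2 * ρ + j * δ ≤ 3 * ρ ∧ ∃ k : ℕ, ∀ i ≤ γ.walk.length,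 dist (Literature.Probability.LatticeModels.meshPoint δ (γ.walk.getVert i)) c < 2 * ρ + j * δ ↔ i ≤ k}

/-- item stmt-CriticalPhenomena-5463 · crux · rank 3 · open · by planner
why it might fail: Boundary-Harnack/separation lemma for critical-SAW exit-edge laws, uniform in near data: known for LERW (Markov) and percolation (RSW/FKG), never SAW; near data forcing tangential exits along the flat line, and thin lattice bands at ρ=2δ where screen-data supports nearly separate, may push it to 0.
sources: Masson2009, arXiv:0806.0357, GarbanPeteSchramm2013Pivotal, arXiv:1008.1378, BenesLawlerViklund2015, DuminilCopinHammond2013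
[crux] S2 of the card (CrossingHarnack) in the integrated form the coupling consumes. Universal c₁ >
0: same far geometry as S1 (flat in B(c,4ρ)), two near data (K, a), (K′, a′) inside B̄(c,ρ), same
target b: the laws of the CANONICAL SCREEN DATA (smallest grid radius r_j ∈ [2ρ,3ρ] crossed exactly
once, and its exit edge (x,y)) under the two laws overlap: Σ_{(j,x,y)} min(P_{K,a}, P_{K′,a′}) ≥ c₁
— maximal coupling of the screen succeeds with probability ≥ c₁, after which the suffix laws
(x_c-SAW from y to b outside the ball) coincide exactly. [deps: CircleBridgeAbundance] [difficulty:
XL] -/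
@[route_item "route-CriticalPhenomena-SAWCircleScreening", crux]
def ScreenOverlap : Prop :=
  ∃ c₁ : ℝ, 0 < c₁ ∧ ∀ (D : Literature.Probability.RandomPlanarGeometry.JordanDomain) (K K' : Set ℂ) (c u : ℂ) (δ ρ : ℝ) (a a' b : Literature.Probability.LatticeModels.Site 2), 0 < δ → 2 * δ ≤ ρ → K ⊆ Metric.closedBall c ρ → K' ⊆ Metric.closedBall c ρ → D.carrier ∩ Metric.ball c (4 * ρ) = {z | u = 0 ∨ 0 < ((z - c) * u).im} ∩ Metric.ball c (4 * ρ) → dist (Literature.Probability.LatticeModels.meshPoint δ a) c ≤ ρ → dist (Literature.Probability.LatticeModels.meshPoint δ a') c ≤ ρ → 4 * ρ ≤ dist (Literature.Probability.LatticeModels.meshPoint δ b) c → (Literature.Probability.LatticeModels.discreteDomainGraph (D.carrier \ K) δ).Reachable a b → (Literature.Probability.LatticeModels.discreteDomainGraph (D.carrier \ K') δ).Reachable a' b → ENNReal.ofReal c₁ ≤ ∑' p : ℕ × Literature.Probability.LatticeModels.Site 2 × Literature.Probability.LatticeModels.Site 2, min (Literature.Probability.RandomPlanarGeometry.SAW.law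 (D.carrier \ K) δ a b {γ | 2 * ρ + p.1 * δ ≤ 3 * ρ ∧ (∃ k : ℕ, (∀ i ≤ γ.walk.length, dist (Literature.Probability.LatticeModels.meshPoint δ (γ.walk.getVert i)) c < 2 * ρ + p.1 * δ ↔ i ≤ k) ∧ γ.walk.getVert k = p.2.1 ∧ γ.walk.getVert (k + 1) = p.2.2) ∧ ∀ j < p.1, ¬ ∃ k : ℕ, ∀ i ≤ γ.walk.length, dist (Literature.Probability.LatticeModels.meshPoint δ (γ.walk.getVert i)) c < 2 * ρ + j * δ ↔ i ≤ k}) (Literature.Probability.RandomPlanarGeometry.SAW.law (D.carrier \ K') δ a' b {γ | 2 * ρ + p.1 * δ ≤ 3 * ρ ∧ (∃ k : ℕ, (∀ i ≤ γ.walk.length, dist (Literature.Probability.LatticeModels.meshPoint δ (γ.walk.getVert i)) c < 2 * ρ + p.1 * δ ↔ i ≤ k) ∧ γ.walk.getVert k = p.2.1 ∧ γ.walk.getVert (k + 1) = p.2.2) ∧ ∀ j < p.1, ¬ ∃ k : ℕ, ∀ i ≤ γ.walk.length, dist (Literature.Probability.LatticeModels.meshPoint δ (γ.walk.getVert i)) c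 < 2 * ρ + j * δ ↔ i ≤ k})

/-- item stmt-CriticalPhenomena-5464 · crux · rank 4 · open · by planner
why it might fail: δ-uniform arm-type bound (return to 3ρ after reaching Mρ → 0 in M) for x_c-SAW without RSW/FKG (KS verify G2/G3 only via FKG); far geometry beyond Mρ is arbitrary Jordan: dead-end fjords invite O(1)-penalised excursions whose return leg is a 2-arm event with unproved lattice exponent.
sources: KemppainenSmirnov2017, arXiv:1212.6215, DuminilCopinHammond2013, DuminilCopinGangulyHammondManolescu2020, arXiv:1809.00760, AizenmanBurchardDuke1999
[crux] S3 (the input the card's recursion silently needs: single crossing is decided only at the end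
of the walk, so the scale iteration is made adapted by proxy screens at the exit time of B(c,Mρ)
plus control of DEEP RETURNS). For every ε > 0 there is M ≥ 4 such that, uniformly over Jordan far
geometry flat in B(c,Mρ), near data K ⊆ B̄(c,ρ), start within ρ, target beyond Mρ:
law-probability(after first reaching distance ≥ Mρ from c the walk comes back within 3ρ of c) ≤ ε. A
Kemppainen–Smirnov G3-type power bound restricted to annuli concentric at the start. [difficulty: L] -/
@[route_item "route-CriticalPhenomena-SAWCircleScreening", crux]
def NoDeepReturn : Prop :=
  ∀ ε : ℝ, 0 < ε → ∃ M : ℝ, 4 ≤ M ∧ ∀ (D : Literature.Probability.RandomPlanarGeometry.JordanDomain) (K : Set ℂ) (c u : ℂ) (δ ρ : ℝ) (a b : Literature.Probability.LatticeModels.Site 2), 0 < δ → 2 * δ ≤ ρ → K ⊆ Metric.closedBall c ρ → D.carrier ∩ Metric.ball c (M * ρ) = {z | u = 0 ∨ 0 < ((z - c) * u).im} ∩ Metric.ball c (M * ρ) → dist (Literature.Probability.LatticeModels.meshPoint δ a) c ≤ ρ → M * ρ ≤ dist (Literature.Probability.LatticeModels.meshPoint δ b) c → (Literature.Probability.LatticeModels.discreteDomainGraph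 (D.carrier \ K) δ).Reachable a b → Literature.Probability.RandomPlanarGeometry.SAW.law (D.carrier \ K) δ a b {γ | ∃ i i' : ℕ, i < i' ∧ i' ≤ γ.walk.length ∧ M * ρ ≤ dist (Literature.Probability.LatticeModels.meshPoint δ (γ.walk.getVert i)) c ∧ dist (Literature.Probability.LatticeModels.meshPoint δ (γ.walk.getVert i')) c < 3 * ρ} ≤ ENNReal.ofReal ε

/-- item stmt-CriticalPhenomena-5465 · crux · rank 5 · open · by planner
why it might fail: Known only as a consequence of the conjunct; at rough prime ends no Euclidean screen applies at any δ (tame→general undecomposed); Kennedy–Lawler see lattice effects persist in boundary scaling limits — they must wash out of the normalised curve law for EVERY IsEndpointApprox (mesoscopic starts).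
sources: KennedyLawler2013, arXiv:1109.3091, LawlerSchrammWerner2004SAW, DuminilCopinSmirnov2012, Billingsley1999, KemppainenSmirnov2017
[crux] (EC), the conjunct-facing deliverable (card J3, coupling form of the guard
stmt-CriticalPhenomena-0776): for every Dobrushin domain D and endpoint approximations (a,b),
(a′,b′), the Lévy–Prokhorov distance between the pushed-forward laws law_δ(a_δ,b_δ)∘curve⁻¹ and
law_δ(a′_δ,b′_δ)∘curve⁻¹ on CurveClass ℂ tends to 0 as δ → 0+. For domains flat near both marked
points it follows from S2 ∧ S3 (support ScreeningRecursion); general Jordan domains are NOT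
decomposed yet. [deps: ScreenOverlap, NoDeepReturn] [difficulty: XL] -/
@[route_item "route-CriticalPhenomena-SAWCircleScreening", crux]
def EndpointCoupling : Prop :=
  ∀ (D : Literature.Probability.RandomPlanarGeometry.DobrushinDomain) (a b a' b' : ℝ → Literature.Probability.LatticeModels.Site 2), Literature.Probability.RandomPlanarGeometry.SAW.IsEndpointApprox D a b → Literature.Probability.RandomPlanarGeometry.SAW.IsEndpointApprox D a' b' → Filter.Tendsto (fun δ => MeasureTheory.levyProkhorovDist ((Literature.Probability.RandomPlanarGeometry.SAW.law D.carrier δ (a δ) (b δ)).map (fun γ => γ.curve)) ((Literature.Probability.RandomPlanarGeometry.SAW.law D.carrier δ (a' δ) (b' δ)).map (fun γ => γ.curve))) (nhdsWithin 0 (Set.Ioi 0)) (nhds 0)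

/-- item stmt-CriticalPhenomena-5466 · crux · rank 6 · open · by planner
why it might fail: It is the Lawler–Schramm–Werner conjecture for one endpoint convention per domain: open on every planar lattice (proved only on random quadrangulations/LQG, Gwynne–Miller); on ℤ² no parafermionic observable is available and even tightness/precompactness of the critical two-point law is unproved.
sources: LawlerSchrammWerner2004SAW, arXiv:math/0204277, DuminilCopinSmirnov2012, GwynneMiller2021SAW, arXiv:1608.00956, DuminilCopinHammond2013
[crux] (I₁), the identification input, deliberately the WEAKEST form: for every Dobrushin domain
there EXIST endpoint approximations (a,b) with IsEndpointApprox along which the critical SAW law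
converges to chordal SLE_{8/3} (ConvergesInLawToSLE 8/3). Any convention proved by any
identification route (parafermion, restriction rigidity, FKG+AB, …) discharges it; not this route's
mechanism and not to be staffed through it. [difficulty: open-problem] -/
@[route_item "route-CriticalPhenomena-SAWCircleScreening", crux]
def SomeApproxLimit : Prop :=
  ∀ D : Literature.Probability.RandomPlanarGeometry.DobrushinDomain, ∃ a b : ℝ → Literature.Probability.LatticeModels.Site 2, Literature.Probability.RandomPlanarGeometry.SAW.IsEndpointApprox D a b ∧ Literature.Probability.RandomPlanarGeometry.ConvergesInLawToSLE ((8 : NNReal) / 3) D (fun δ (γ : Literature.Probability.RandomPlanarGeometry.SAW.DomainSAW D.carrier δ (a δ) (b δ)) => γ.curve) (fun δ => Literature.Probability.RandomPlanarGeometry.SAW.law D.carrier δ (a δ) (b δ))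

/-- item stmt-CriticalPhenomena-14157 · support · rank 9 · closed · proved by Summit.CriticalPhenomena.SAWScalingLimit.Theorems.CruxesGiveTarget_proof (prover) · by planner
[support] Glue concluding the target: EndpointCoupling → SomeApproxLimit → Target. Target (rank 0)
is the conjunction (EC) ∧ (I₁) with both conjuncts inlined verbatim (it renders before the crux
decls, so it cannot name them); its first conjunct is literally the text of EndpointCoupling and its
second literally the text of SomeApproxLimit, so the proof is definitional unfolding, `fun h₁ h₂ =>
⟨h₁, h₂⟩` (checked in the planner's Sketch.lean against the route module, lean rc 0). Filed by the
route-choice repair of 2026-08-16 (gate lint route.target-unreachable: no item concluded Target); it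
makes the item graph read cruxes #5, #6 → Target → (Assembly / closes) → SAWScalingLimit. [deps:
EndpointCoupling, SomeApproxLimit] [difficulty: S] -/
@[route_item "route-CriticalPhenomena-SAWCircleScreening", crux]
def CruxesGiveTarget : Prop :=
  EndpointCoupling → SomeApproxLimit → Target

/-- item stmt-CriticalPhenomena-5467 · support · rank 9 · open · by planner
sources: Summits/CriticalPhenomena/SAWScalingLimit/Ideas/circle-bridge-screening.md (J3), KennedyLawler2013
[support] (EC) restricted to Dobrushin domains that are EXACTLY flat (open half-discs) in some ball
around each marked point — the class where the lattice engine applies verbatim at all small scales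
(rectangles and polygons with marked points on edges, half-discs, …). Target of the glue
ScreeningRecursion; also provable from EndpointCoupling in one line. [difficulty: L] -/
@[route_item "route-CriticalPhenomena-SAWCircleScreening", crux]
def EndpointCouplingTame : Prop :=
  ∀ (D : Literature.Probability.RandomPlanarGeometry.DobrushinDomain) (a b a' b' : ℝ → Literature.Probability.LatticeModels.Site 2), (∃ (ρ₀ : ℝ) (u₀ u₁ : ℂ), 0 < ρ₀ ∧ D.carrier ∩ Metric.ball (D.pt 0) ρ₀ = {z | u₀ = 0 ∨ 0 < ((z - D.pt 0) * u₀).im} ∩ Metric.ball (D.pt 0) ρ₀ ∧ D.carrier ∩ Metric.ball (D.pt 1) ρ₀ = {z | u₁ = 0 ∨ 0 < ((z - D.pt 1) * u₁).im} ∩ Metric.ball (D.pt 1) ρ₀) → Literature.Probability.RandomPlanarGeometry.SAW.IsEndpointApprox D a b → Literature.Probability.RandomPlanarGeometry.SAW.IsEndpointApprox D a' b' → Filter.Tendsto (fun δ => MeasureTheory.levyProkhorovDist ((Literature.Probability.RandomPlanarGeometry.SAW.law D.carrier δ (a δ) (b δ)).map (fun γ => γ.curve)) ((Literature.Probability.RandomPlanarGeometry.SAW.law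 D.carrier δ (a' δ) (b' δ)).map (fun γ => γ.curve))) (nhdsWithin 0 (Set.Ioi 0)) (nhds 0)

/-- item stmt-CriticalPhenomena-5468 · support · rank 9 · closed · proved by Summit.CriticalPhenomena.SAWScalingLimit.Theorems.ScreeningRecursion.screeningRecursion_proof @ e26709849dd0 (prover) · by planner
sources: GarbanPeteSchramm2013Pivotal (§3 proof of Prop. 11: induction over scales r_i = 8^{N−i}r), Masson2009 (Thm 4.7/4.10), AlbertsDuminilCopin2010 (§4: renewal at bridge lines / non-adaptedness of bridge times handled by an enlarged filtration), Billingsley1999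
[support] the card's mechanism as a theorem: ScreenOverlap → NoDeepReturn → EndpointCouplingTame.
Proof plan (planner notes): (i) EXACT SCREEN — on {canonical screen = (r_j,(x,y))} the law
factorises as (prefix law inside B(c,r_j)) ⊗ (x_c-SAW from y to b in (D∖K)_δ outside the open ball),
the second factor independent of the near data (realise it as SAW.law (D ∖ K″) with K″ = ball minus
chord segments); (ii) scales ρ_i = M^i ρ_0 about c = D.pt 0: maximal coupling of screen data
succeeds w.p. ≥ c₁ (S2), mismatched/none branches are mixtures of class laws at scale ρ_{i+1} by
domain Markov at the exit time of B(c,Mρ_i) (past vertices as near data), up to the deep-return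
error η(M) (S3): d_i ≤ (1−c₁)d_{i+1} + Cη(M), so d_0 ≤ (1−c₁)^m + Cη(M)/c₁; choose M then δ (m(δ) →
∞ since δ·a_δ, δ·a′_δ → pt 0); (iii) coupled walks agree after a single exit of B(pt 0, ρ_m) ⇒ curve
distance ≤ 2ρ_m; same at pt 1 by exact reversal of SAW.law; Strassen-free LP bound from the
coupling; largest-component bookkeeping (small balls never carry the largest component).
[difficulty: L] -/
@[route_item "route-CriticalPhenomena-SAWCircleScreening", crux]
def ScreeningRecursion : Prop :=
  ScreenOverlap → NoDeepReturn → EndpointCouplingTame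

/-- item stmt-CriticalPhenomena-6981 · support · rank 9 · closed · proved by Summit.CriticalPhenomena.SAWScalingLimit.Theorems.ChordalSLE83Exists_proof @ 93199528ccef (prover) · by planner
[support] needs-fact: Literature.Probability.RandomPlanarGeometry.exists_isSLECurve (route-repair
2026-08-15, cone guardrail 16 unproved). Chordal SLE_{8/3} EXISTS as a random curve in every
Dobrushin domain: ∀ D, ∃ Γ, IsSLECurve (8/3) D Γ — the κ = 8/3 instance of the named fact
exists_isSLECurve (inputs: Rohde–Schramm 2005 Thm 5.1 trace for κ ≠ 8, discharged as
hasSLETrace_of_ne_eight_holds; transience RS05 Thm 7.1 = tendsto_norm_sleTrace_atTop, undischarged;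
Carathéodory boundary extension of a chordal uniformizing map, ConformalMap facts discharged). It is
the existence half of what any proof of SomeApproxLimit (ConvergesInLawToSLE 8/3 := ∃ Γ, IsSLECurve
… ∧ …) must produce, hence the ONE undischarged cone fact an item of this route consumes; one line
from the fact once discharged (fun D => h (by positivity) D; checked in the planner sketch). Cone
audit of the route: no other item uses a named fact — CircleBridgeAbundance, ScreenOverlap,
NoDeepReturn, ScreeningRecursion, EndpointCouplingTame, EndpointCoupling are statements over SAW.law
/ discreteDomainGraph / meshPoint only; the Assembly needs 0 < x_c
(LawlerSchrammWerner2004SAW_connectiveConstant_bounds_holds, discharged) and -/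
@[route_item "route-CriticalPhenomena-SAWCircleScreening", crux]
def ChordalSLE83Exists : Prop :=
  ∀ D : Literature.Probability.RandomPlanarGeometry.DobrushinDomain, ∃ Γ : (NNReal → ℝ) → Literature.Probability.RandomPlanarGeometry.CurveClass ℂ, Literature.Probability.RandomPlanarGeometry.IsSLECurve ((8 : NNReal) / 3) D Γ

/-- item stmt-CriticalPhenomena-5469 · assembly · rank 1 · closed · proved by Summit.CriticalPhenomena.SAWScalingLimit.Theorems.assembly_proof (prover) · by planner
sources: Billingsley1999, LawlerSchrammWerner2004SAW
[assembly] EndpointCoupling → SomeApproxLimit → SAWScalingLimit. -/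
@[route_item "route-CriticalPhenomena-SAWCircleScreening", crux]
def Assembly : Prop :=
  EndpointCoupling → SomeApproxLimit → SAWScalingLimit

/-! D-0027 §2.1 — DECIDING THEOREM (planner-authored via `route open/edit --closes-file`; by planner-rchoice-CriticalPhenomena-SAWCircleScr-c9f1a85e-0 2026-08-16T03:30:50Z):
its hypotheses are this route's items and its conclusion the sub-problem Statement (glue_lint), and it elaborates with this file. -/

@[closes "route-CriticalPhenomena-SAWCircleScreening"] theorem closes : Target → CircleBridgeAbundance → ScreenOverlap → NoDeepReturn → EndpointCoupling → SomeApproxLimit → EndpointCouplingTame → ScreeningRecursion → ChordalSLE83Exists → CruxesGiveTarget → Assembly → _root_.SAWScalingLimit :=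
  fun _h_Target _h_CircleBridgeAbundance _h_ScreenOverlap _h_NoDeepReturn h_EndpointCoupling h_SomeApproxLimit _h_EndpointCouplingTame _h_ScreeningRecursion _h_ChordalSLE83Exists h_CruxesGiveTarget h_Assembly =>
    have h_Target : Target := h_CruxesGiveTarget h_EndpointCoupling h_SomeApproxLimit
    h_Assembly h_Target.1 h_Target.2

end Summit.CriticalPhenomena.SAWScalingLimit.Theses.SAWCircleScreening
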